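import Literature.Probability.Process.KakutaniGaussianShifts
import Mathlib.Probability.Independence.Basic
import Mathlib.Probability.Distributions.Gaussian.Real
import HarnessLib

/-!
# Route `ColdStartUniversality`, crux K_A1 `UniformColdStartMixing` (stmt-QuantumFields-24809), rung `stub_fixedCutoffMixing`:
# E-block brick 1 — the Gaussian shift identity (one-dimensional Cameron–Martin) and the one-step discrete Girsanov identity

Helper file (seat `ym-line-csu-p1`, g7).  The transfer of the Doeblin minorisation from `β' = 0` to `β' > 0` goes through a
DISCRETE Girsanov formula for Euler schemes (plan: `Cruxes/UniformColdStartMixing/Lines/rung_fixedCutoffMixing.md`, E-block).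
Its only probabilistic input is the elementary change of variables for a real Gaussian:

* `integral_mul_exp_gaussianReal_eq_integral_add` — `∫ g(x) e^{θx - hθ²/2} dN(0,h)(x) = ∫ g(x + hθ) dN(0,h)(x)` (bounded measurable
  `g`; the density of `N(hθ, h)` w.r.t. `N(0, h)`, tree `rnDeriv_gaussianReal_shift_ae_eq`, and Mathlib `gaussianReal_map_add_const`);
* `integral_comp_sub_mul_exp_eq_of_indepFun` — **one-step discrete Girsanov**: if `ζ ~ N(0,h)` is independent of `Y` and `θ`, `F`
  are bounded measurable, `E[F(Y, ζ - hθ(Y)) e^{θ(Y)ζ - hθ(Y)²/2}] = E[F(Y, ζ)]` (Fubini over the independent pair).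

No definition, no sorry.  RECORD-rung R3 plumbing; nothing here bears on the mass gap.
-/

set_option autoImplicit false

noncomputable section

namespace Summit.QuantumFields.YangMills.Theorems.ColdStartUniversality

open MeasureTheory ProbabilityTheory Filter
open scoped NNReal ENNReal

/-- **Gaussian shift identity (Cameron–Martin in dimension one)**: for `h > 0`, `θ ∈ ℝ` and bounded measurable `g`,
`∫ g(x) exp(θ x - h θ²/2) dN(0,h)(x) = ∫ g(x + h θ) dN(0,h)(x)` (measurable `g`; both sides carry the same junk value when
non-integrable). [folklore] -/
theorem integral_mul_exp_gaussianReal_eq_integral_add {h : ℝ≥0} (hh : h ≠ 0) (θ : ℝ) {g : ℝ → ℝ} (hg : Measurable g) :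
    ∫ x, g x * Real.exp (θ * x - (h : ℝ) * θ ^ 2 / 2) ∂(gaussianReal 0 h) =
      ∫ x, g (x + (h : ℝ) * θ) ∂(gaussianReal 0 h) := by
  -- `∫ g(x + hθ) dN(0,h) = ∫ g dN(hθ, h)`
  have hmap : (gaussianReal 0 h).map (fun x => x + (h : ℝ) * θ) = gaussianReal ((h : ℝ) * θ) h := by
    rw [gaussianReal_map_add_const, zero_add]
  have hR : ∫ x, g (x + (h : ℝ) * θ) ∂(gaussianReal 0 h) = ∫ x, g x ∂(gaussianReal ((h : ℝ) * θ) h) := by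
    rw [← hmap]
    have hφ : AEMeasurable (fun x : ℝ => x + (h : ℝ) * θ) (gaussianReal 0 h) := (measurable_id.add_const _).aemeasurable
    exact (integral_map hφ hg.aestronglyMeasurable).symm
  -- `∫ g dN(hθ, h) = ∫ (dN(hθ,h)/dN(0,h)) g dN(0,h)` and the density is `exp(θ x - hθ²/2)`
  have hac : gaussianReal ((h : ℝ) * θ) h ≪ gaussianReal 0 h :=
    Literature.Probability.Process.gaussianReal_absolutelyContinuous_gaussianReal hh _ _
  have hL : ∫ x, g x ∂(gaussianReal ((h : ℝ) * θ) h) =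
      ∫ x, ((gaussianReal ((h : ℝ) * θ) h).rnDeriv (gaussianReal 0 h) x).toReal * g x ∂(gaussianReal 0 h) := by
    rw [← integral_rnDeriv_smul hac]
    rfl
  rw [hR, hL]
  refine integral_congr_ae ?_
  filter_upwards [Literature.Probability.Process.rnDeriv_gaussianReal_shift_ae_eq hh ((h : ℝ) * θ) 0] with x hx
  rw [hx, ENNReal.toReal_ofReal (Real.exp_pos _).le, mul_comm]
  congr 2
  have hh' : (h : ℝ) ≠ 0 := NNReal.coe_ne_zero.2 hh
  field_simp
  ring

/-- Integrating out an independent variable, integrable version: if `U ⟂ ξ` and `g` is integrable for the product of the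
laws then `E g(U, ξ) = E[∫ g(U, e) dLaw(ξ)(e)]`. [folklore] -/
theorem integral_comp_eq_integral_integral_of_indepFun' {Ω α β : Type*} [MeasurableSpace Ω] {P : Measure Ω}
    [IsProbabilityMeasure P] [MeasurableSpace α] [MeasurableSpace β] {U : Ω → α} {ξ : Ω → β} (hU : Measurable U)
    (hξ : Measurable ξ) (hind : IndepFun U ξ P) {g : α × β → ℝ} (hg : Measurable g)
    (hgi : Integrable g ((P.map U).prod (P.map ξ))) :
    ∫ ω, g (U ω, ξ ω) ∂P = ∫ ω, (∫ e, g (U ω, e) ∂(P.map ξ)) ∂P := by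
  have hprod := (indepFun_iff_map_prod_eq_prod_map_map hU.aemeasurable hξ.aemeasurable).1 hind
  haveI : IsProbabilityMeasure (P.map U) := Measure.isProbabilityMeasure_map hU.aemeasurable
  haveI : IsProbabilityMeasure (P.map ξ) := Measure.isProbabilityMeasure_map hξ.aemeasurable
  calc ∫ ω, g (U ω, ξ ω) ∂P = ∫ p, g p ∂(P.map fun ω => (U ω, ξ ω)) := by
        rw [integral_map (hU.prodMk hξ).aemeasurable hg.aestronglyMeasurable]
    _ = ∫ p, g p ∂((P.map U).prod (P.map ξ)) := by rw [hprod]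
    _ = ∫ u, (∫ e, g (u, e) ∂(P.map ξ)) ∂(P.map U) := integral_prod g hgi
    _ = ∫ ω, (∫ e, g (U ω, e) ∂(P.map ξ)) ∂P := by
        rw [integral_map hU.aemeasurable]
        exact (hg.stronglyMeasurable.integral_prod_right').aestronglyMeasurable

/-- `x ↦ exp(c |x|)` is integrable for a real Gaussian. [folklore] -/
theorem integrable_exp_mul_abs_gaussianReal (m : ℝ) (v : ℝ≥0) (c : ℝ) :
    Integrable (fun x : ℝ => Real.exp (c * |x|)) (gaussianReal m v) := by
  have h1 := integrable_exp_mul_gaussianReal (μ := m) (v := v) c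
  have h2 := integrable_exp_mul_gaussianReal (μ := m) (v := v) (-c)
  refine (h1.add h2).mono' (by fun_prop) (Eventually.of_forall fun x => ?_)
  rw [Real.norm_eq_abs, abs_of_nonneg (Real.exp_pos _).le]
  rcases le_total 0 x with hx | hx
  · rw [abs_of_nonneg hx]
    have : 0 ≤ Real.exp (-c * x) := (Real.exp_pos _).le
    simp only [Pi.add_apply]
    linarith
  · rw [abs_of_nonpos hx]
    have : 0 ≤ Real.exp (c * x) := (Real.exp_pos _).le
    simp only [Pi.add_apply]
    rw [show c * -x = -c * x by ring]
    linarith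

/-- **One-step discrete Girsanov identity.**  On a probability space let `ζ ~ N(0, h)` (`h > 0`) be independent of a random
element `Y`, and let `θ`, `F` be bounded measurable.  Then
`E[F(Y, ζ - h θ(Y)) · exp(θ(Y) ζ - h θ(Y)²/2)] = E[F(Y, ζ)]`: under the exponentially tilted measure the shifted Gaussian
is again `N(0, h)`. [folklore] -/
theorem integral_comp_sub_mul_exp_eq_of_indepFun {Ω S : Type*} [MeasurableSpace Ω] {P : Measure Ω} [IsProbabilityMeasure P]
    [MeasurableSpace S] {Y : Ω → S} {ζ : Ω → ℝ} (hY : Measurable Y) (hζ : Measurable ζ) (hind : IndepFun Y ζ P)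
    {h : ℝ≥0} (hh : h ≠ 0) (hlaw : P.map ζ = gaussianReal 0 h)
    {θ : S → ℝ} (hθ : Measurable θ) {T : ℝ} (hT : ∀ s, |θ s| ≤ T)
    {F : S × ℝ → ℝ} (hF : Measurable F) {C : ℝ} (hC : ∀ p, |F p| ≤ C) :
    ∫ ω, F (Y ω, ζ ω - (h : ℝ) * θ (Y ω)) * Real.exp (θ (Y ω) * ζ ω - (h : ℝ) * θ (Y ω) ^ 2 / 2) ∂P =
      ∫ ω, F (Y ω, ζ ω) ∂P := by
  haveI : IsProbabilityMeasure (P.map Y) := Measure.isProbabilityMeasure_map hY.aemeasurable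
  have hC0 : 0 ≤ C := by
    rcases isEmpty_or_nonempty Ω with hΩ | ⟨⟨ω⟩⟩
    · exact absurd (measure_univ (μ := P)) (by simp [Set.univ_eq_empty_iff.2 hΩ])
    · exact (abs_nonneg _).trans (hC (Y ω, ζ ω))
  -- the tilted integrand as a function of the pair
  set g : S × ℝ → ℝ := fun p => F (p.1, p.2 - (h : ℝ) * θ p.1) * Real.exp (θ p.1 * p.2 - (h : ℝ) * θ p.1 ^ 2 / 2) with hg
  have hgm : Measurable g := by
    refine Measurable.mul (hF.comp (measurable_fst.prodMk (measurable_snd.sub ((hθ.comp measurable_fst).const_mul _))))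
      (Real.measurable_exp.comp ?_)
    exact ((hθ.comp measurable_fst).mul measurable_snd).sub (((hθ.comp measurable_fst).pow_const 2).const_mul _ |>.div_const _)
  -- domination `|g(s, x)| ≤ C exp(T |x|)`
  have hdom : ∀ p : S × ℝ, ‖g p‖ ≤ C * Real.exp (T * |p.2|) := by
    intro p
    rw [Real.norm_eq_abs, hg, abs_mul, abs_of_nonneg (Real.exp_pos _).le]
    refine mul_le_mul (hC _) (Real.exp_le_exp.2 ?_) (Real.exp_pos _).le hC0
    have h1 : θ p.1 * p.2 ≤ T * |p.2| := by
      calc θ p.1 * p.2 ≤ |θ p.1 * p.2| := le_abs_self _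
        _ = |θ p.1| * |p.2| := abs_mul _ _
        _ ≤ T * |p.2| := mul_le_mul_of_nonneg_right (hT _) (abs_nonneg _)
    have h2 : 0 ≤ (h : ℝ) * θ p.1 ^ 2 / 2 := by positivity
    linarith
  have hgi : Integrable g ((P.map Y).prod (P.map ζ)) := by
    rw [hlaw]
    have hI : Integrable (fun p : S × ℝ => C * Real.exp (T * |p.2|)) ((P.map Y).prod (gaussianReal 0 h)) :=
      ((integrable_exp_mul_abs_gaussianReal 0 h T).const_mul C).comp_snd (P.map Y)
    exact hI.mono' hgm.aestronglyMeasurable (Eventually.of_forall hdom)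
  -- Fubini on the independent pair, the shift identity in the inner integral, Fubini back
  have h1 := integral_comp_eq_integral_integral_of_indepFun' hY hζ hind hgm hgi
  have h2 : ∀ s : S, ∫ e, g (s, e) ∂(P.map ζ) = ∫ e, F (s, e) ∂(P.map ζ) := by
    intro s
    rw [hlaw]
    have hshift := integral_mul_exp_gaussianReal_eq_integral_add hh (θ s)
      (g := fun x => F (s, x - (h : ℝ) * θ s)) (hF.comp (measurable_const.prodMk (measurable_id.sub_const _)))
    simp only [hg]
    rw [hshift]
    refine integral_congr_ae (Eventually.of_forall fun x => ?_)
    simp only [add_sub_cancel_right]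
  have hFi : Integrable (fun p : S × ℝ => F p) ((P.map Y).prod (P.map ζ)) :=
    Integrable.of_bound hF.aestronglyMeasurable C (Eventually.of_forall fun p => by rw [Real.norm_eq_abs]; exact hC p)
  have h3 := integral_comp_eq_integral_integral_of_indepFun' hY hζ hind hF hFi
  calc ∫ ω, F (Y ω, ζ ω - (h : ℝ) * θ (Y ω)) * Real.exp (θ (Y ω) * ζ ω - (h : ℝ) * θ (Y ω) ^ 2 / 2) ∂P
      = ∫ ω, g (Y ω, ζ ω) ∂P := by rfl
    _ = ∫ ω, (∫ e, g (Y ω, e) ∂(P.map ζ)) ∂P := h1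
    _ = ∫ ω, (∫ e, F (Y ω, e) ∂(P.map ζ)) ∂P := by simp_rw [h2]
    _ = ∫ ω, F (Y ω, ζ ω) ∂P := h3.symm

end Summit.QuantumFields.YangMills.Theorems.ColdStartUniversality

end
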